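import Literature.Barriers.PneNP.TSPExtensionComplexity
import Mathlib.Data.Matrix.ColumnRowPartitioned
import HarnessLib

/-!
# Extension complexity is monotone under faces and coordinate projections

Support file for the extension-complexity barrier facts of
`Literature.Barriers.PneNP.TSPExtensionComplexity` (generic in the polytope). FMPTW 2015,
Lemma 9 / Rothvoß 2017, §1: "if `F` is a face of `P` then `xc(F) ≤ xc(P)`", and an extension of
an extension is an extension; here in the concrete `HasEFOfSize` (slack form) currency:

* `hasEFOfSize_of_system` — a slack-form system with rows and slack variables indexed by ANY
  finite types (re-indexed through `Fintype.equivFin`) witnesses `HasEFOfSize` of its projection,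
  of size the number of slack variables.
* `HasEFOfSize.inter_eqs` — intersecting with finitely many hyperplanes `c_t · x = δ_t` (in
  particular: a face `P ∩ {x_e = 0, e ∉ G}` cut out by valid equalities) keeps the size: append
  the equations as rows.
* `HasEFOfSize.image_comp` — for `P` inside the nonnegative orthant (every `0/1`-polytope), the
  coordinate map `x ↦ x ∘ f` (restriction / projection to a sub-family of coordinates, possibly
  with repetitions) has `HasEFOfSize (π P) (|ι| + r)`: the old natural variables become sign-
  constrained extra variables (valid, as `P ≥ 0`), at an additive cost of `|ι|` inequalities —
  immaterial for `2^{Ω(n)}` bounds (the printed Lemma 9 has no loss because its EFs allow free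
  extra variables; slack form does not).

Sources: [FioriniEtAl2015] Lemma 9 (PDF p. 10); [Rothvoss2017] §1.1 (PDF p. 4: "a linear
projection of a face of the TSP polytope ... This immediately implies a lower bound").
-/

noncomputable section

namespace Literature.Barriers.PneNP

open Matrix Finset

variable {ι : Type} [Fintype ι] {r : ℕ}

/-- Componentwise reading of an equation between `Sum.elim`-vectors. [folklore] -/
theorem sumElim_add_sumElim_eq_sumElim_iff {α β : Type*} (u u' g : α → ℝ) (v v' d : β → ℝ) :
    Sum.elim u v + Sum.elim u' v' = Sum.elim g d ↔ u + u' = g ∧ v + v' = d := by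
  constructor
  · intro h
    refine ⟨funext fun a => ?_, funext fun b => ?_⟩
    · simpa using congrFun h (Sum.inl a)
    · simpa using congrFun h (Sum.inr b)
  · rintro ⟨h1, h2⟩
    funext s
    rcases s with a | b
    · simpa using congrFun h1 a
    · simpa using congrFun h2 b

/-- **A slack-form system with arbitrary finite index types is an EF.** For rows indexed by `ρ`
and slack variables indexed by `σ`, the projection `{x | ∃ y ≥ 0, E x + F y = g}` satisfies
`HasEFOfSize · |σ|` (re-index rows and slack variables through `Fintype.equivFin`). [folklore] -/
theorem hasEFOfSize_of_system {ρ σ : Type} [Fintype ρ] [Fintype σ] (E : Matrix ρ ι ℝ)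
    (F : Matrix ρ σ ℝ) (g : ρ → ℝ) :
    HasEFOfSize {x | ∃ y : σ → ℝ, (∀ j, 0 ≤ y j) ∧ E *ᵥ x + F *ᵥ y = g} (Fintype.card σ) := by
  classical
  set eρ := Fintype.equivFin ρ with heρ
  set eσ := Fintype.equivFin σ with heσ
  refine ⟨⟨Fintype.card ρ, E.submatrix eρ.symm id, F.submatrix eρ.symm eσ.symm, g ∘ eρ.symm⟩,
    ?_⟩
  -- the re-indexed system, row by row
  have hrow : ∀ (x : ι → ℝ) (y : Fin (Fintype.card σ) → ℝ) (i : Fin (Fintype.card ρ)),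
      (E.submatrix eρ.symm id *ᵥ x + F.submatrix eρ.symm eσ.symm *ᵥ y) i =
        (E *ᵥ x + F *ᵥ (y ∘ eσ)) (eρ.symm i) := by
    intro x y i
    simp only [Pi.add_apply, mulVec, dotProduct, submatrix_apply, id_eq, Function.comp_apply]
    congr 1
    rw [← eσ.symm.sum_comp]
    simp
  ext x
  simp only [ExtendedFormulation.projSet, Set.mem_setOf_eq]
  constructor
  · rintro ⟨y, hy, hsys⟩
    refine ⟨y ∘ eσ, fun j => hy _, funext fun i' => ?_⟩
    have := congrFun hsys (eρ i')
    rw [hrow] at this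
    simpa using this
  · rintro ⟨y, hy, hsys⟩
    refine ⟨y ∘ eσ.symm, fun j => hy _, funext fun i => ?_⟩
    rw [hrow]
    have hyy : (y ∘ eσ.symm) ∘ eσ = y := by funext j; simp
    rw [hyy, hsys]
    rfl

/-- **Faces keep the size**: if `P` has a slack-form EF with `r` inequalities then so does
`P ∩ {x | c_t · x = δ_t ∀ t}` for any finite family of equations (append them as rows). With
`c_t = e_t`, `δ_t = 0` for the coordinates outside a subgraph this is the face
`{x ∈ TSP(n) | x_e = 0, e ∉ G}`. [cite: FioriniEtAl2015, Lemma 9 (PDF p. 10)] -/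
theorem HasEFOfSize.inter_eqs {P : Set (ι → ℝ)} (h : HasEFOfSize P r) {T : Type} [Fintype T]
    (c : T → ι → ℝ) (δ : T → ℝ) : HasEFOfSize (P ∩ {x | ∀ t, c t ⬝ᵥ x = δ t}) r := by
  classical
  obtain ⟨Q, hQ⟩ := h
  have h0 := hasEFOfSize_of_system (ι := ι) (fromRows Q.E (Matrix.of fun t i => c t i))
    (fromRows Q.F 0) (Sum.elim Q.g δ)
  rw [Fintype.card_fin] at h0
  convert h0 using 1
  ext x
  simp only [Set.mem_inter_iff, Set.mem_setOf_eq, fromRows_mulVec, zero_mulVec,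
    sumElim_add_sumElim_eq_sumElim_iff, add_zero]
  have hc : (Matrix.of fun t i => c t i) *ᵥ x = fun t => c t ⬝ᵥ x := rfl
  rw [hc, ← hQ]
  simp only [ExtendedFormulation.projSet, Set.mem_setOf_eq]
  constructor
  · rintro ⟨⟨y, hy, hsys⟩, ht⟩
    exact ⟨y, hy, hsys, funext ht⟩
  · rintro ⟨y, hy, hsys, ht⟩
    exact ⟨⟨y, hy, hsys⟩, fun t => congrFun ht t⟩

/-- **Coordinate projections of nonnegative polytopes cost at most `|ι|` inequalities**: if
`P ⊆ ℝ^ι_{≥ 0}` has a slack-form EF with `r` inequalities and `f : κ → ι`, then the image of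
`P` under `x ↦ x ∘ f` (restriction to the coordinates in the range of `f`) has one with
`|ι| + r`: keep the old system with `x` now among the sign-constrained extra variables and add
the rows `z_k - x_{f k} = 0`. [cite: FioriniEtAl2015, Lemma 9 (PDF p. 10)] -/
theorem HasEFOfSize.image_comp {P : Set (ι → ℝ)} (h : HasEFOfSize P r)
    (hP : ∀ x ∈ P, ∀ i, 0 ≤ x i) {κ : Type} [Fintype κ] (f : κ → ι) :
    HasEFOfSize ((fun x : ι → ℝ => x ∘ f) '' P) (Fintype.card ι + r) := by
  classical
  obtain ⟨Q, hQ⟩ := h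
  let Sel : Matrix κ ι ℝ := Matrix.of fun k i => if i = f k then -1 else 0
  have hSel : ∀ x : ι → ℝ, Sel *ᵥ x = fun k => -x (f k) := by
    intro x
    funext k
    simp only [mulVec, dotProduct, Sel, Matrix.of_apply, ite_mul, neg_one_mul, zero_mul,
      Finset.sum_ite_eq', Finset.mem_univ, if_true]
  have h0 := hasEFOfSize_of_system (ι := κ) (fromRows (0 : Matrix (Fin Q.k) κ ℝ) 1)
    (fromRows (fromCols Q.E Q.F) (fromCols Sel 0)) (Sum.elim Q.g 0)
  rw [Fintype.card_sum, Fintype.card_fin] at h0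
  convert h0 using 1
  ext z
  simp only [Set.mem_image, Set.mem_setOf_eq, fromRows_mulVec, zero_mulVec, one_mulVec,
    fromCols_mulVec]
  constructor
  · rintro ⟨x, hxP, rfl⟩
    obtain ⟨y, hy, hsys⟩ : x ∈ Q.projSet := by rw [hQ]; exact hxP
    refine ⟨Sum.elim x y, ?_, ?_⟩
    · rintro (i | j)
      · exact hP x hxP i
      · exact hy j
    · rw [sumElim_add_sumElim_eq_sumElim_iff]
      refine ⟨?_, ?_⟩
      · simpa using hsys
      · simp only [Sum.elim_comp_inl, hSel, add_zero]
        funext k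
        simp
  · rintro ⟨w, hw, hsys⟩
    have hw' : w = Sum.elim (w ∘ Sum.inl) (w ∘ Sum.inr) := by
      funext s; rcases s with i | j <;> rfl
    rw [hw', sumElim_add_sumElim_eq_sumElim_iff] at hsys
    obtain ⟨h1, h2⟩ := hsys
    simp only [Sum.elim_comp_inl, Sum.elim_comp_inr, hSel, add_zero, zero_add] at h1 h2
    refine ⟨w ∘ Sum.inl, ?_, ?_⟩
    · rw [← hQ]
      exact ⟨w ∘ Sum.inr, fun j => hw _, h1⟩
    · funext k
      have := congrFun h2 k
      simp only [Pi.add_apply, Function.comp_apply, Pi.zero_apply] at this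
      simp only [Function.comp_apply]
      linarith

end Literature.Barriers.PneNP

end
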